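import Summits.KontsevichZagierPeriods.Zeta5Search.RVFlatGaugeZoneC
import Summits.KontsevichZagierPeriods.Zeta5Search.RVClassLawCover
import HarnessLib.Audit
import HarnessLib

/-!
# RVFlatGaugeZoneCResidual — gen 11's two-long-block node, decided instance-wise by the tree; the residual node (fam-rv gen 12, file 2; request #12.2)

HONEST FRAMING: systematic search; no irrationality claim unless certified.  Cell `pub-zeta5`, family `rv`, generation 12.
Gen 11 (`RVFlatGaugeZoneC.lean`) typed the class law on ZONE C (exactly two long blocks `i₁ ≠ i₂`, `b₀ < 3p`) with the flat-gauge
bonus, `TwoLongClassLaw : … → refund − N_p + zcBonus b p i₁ i₂ ≤ v_p(Cas_j(b))` (`zcBonus = max(Γ, 0)`), and proved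
`TwoLongClassLaw → FlatGaugeLawZoneC`.  This file applies gen 12 file 1's decidable cover (`RVClassLawCover.coverGuard`, six tree
theorems) at `δ := zcBonus b p i₁ i₂`:

* `twoLongClassLaw_of_coverGuard` — the node AT EVERY INSTANCE WHERE THE GUARD FIRES (PROVED, no conjecture node);
* `TwoLongResidual` — the node restricted to the instances where it does not (OBSERVED statement, minted by this cell from an exact
  census, NOT a published result, used only as an explicit hypothesis);
* `twoLongClassLaw_of_residual : TwoLongResidual → TwoLongClassLaw`, hence `flatGaugeLawZoneC_of_residual`.

EXACT CENSUS (zone C is finite at each prime; COMPLETE at `p = 5`, `b₀ ≤ 14`, and at `p = 7`, `b₀ ≤ 20`; instances `(b, j)` with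
`b`, `b + e_j` in the polytope; `pub-zeta5-fam-rv/gen12/cover6.py` on the rows of `gen11/census_zoneC(2).py`):

| `p` | instances | guard fires | of which `Γ ≤ 0` | residual (`Γ ≥ 1` only) | residual types | node attained |
|-----|-----------|-------------|------------------|--------------------------|----------------|---------------|
| 5   | 2,704     | 1,856 (68.6 %) | 805 of 805    | 848                      | 25             | 803           |
| 7   | 22,098    | 15,756 (71.3 %) | 7,281 of 7,281 | 6,342                  | 51             | 6,070         |

(disjuncts firing, with multiplicity, `p = 5 / 7`: (E) 258 / 2,575, (LB) 1,104 / 9,441, (Z) 512 / 4,576, (J) 609 / 4,578,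
(Y) 39 / 678, (B) 2 / 29.)  So at `p ∈ {5, 7}` the bonus-free class law (CV) holds on ALL of zone C by tree theorems, instance by
instance, and the residual of gen 11's node is exactly its FLAT-SIDE BONUS `Γ ≥ 1` on `¬H(3)` configurations (the cancellation regime
of gen-2 g8: conjugate pairs of two- and three-pole classes inside the inner long block, `E_x` down to `−8`), where the node exceeds
every tree bound by `node − casLB ∈ {1, …, 6}` (`p = 5`: 55, 395, 279, 27, 75, 17 instances).  The two largest residual types are
gen 11's `(f, ⌊d/p⌋, n₂, n₁, n_big) = (2,1,5,0,5)`, `Γ = 2` and `(2,2,5,0,5)`, `Γ = 3` (219 + 291 instances at `p = 5`).  What a proof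
of `TwoLongResidual` needs is therefore NOT a constant-term floor (gen 9/10's mechanism: gen 11 found 54 of the 174 `Γ ≥ 1` types with
`min v_p V − cv < Γ`) but a version WITH BONUS of gen-2's multipole block law (`ClusterValuation.MultiBlockLaw`) on these configurations —
recorded for the next seat in `families/rv/FAMILY.md` §22.  `p`-adic valuations of rational numbers only; nothing about irrationality.
-/

noncomputable section

namespace Summit.KontsevichZagierPeriods.Zeta5Search.RVFlatGauge

open Finset
open Summit.KontsevichZagierPeriods.Zeta5Search.CasoratianValuation (casoratian shift InPolytope pairFloors refund)
open Summit.KontsevichZagierPeriods.Zeta5Search.WedgeDictionary (dOf)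
open Summit.KontsevichZagierPeriods.Zeta5Search.ClusterValuation (GoodClasses casLB multiDepth rungJGuard)
open Cap ZoneC

/-! ### The node wherever the cover guard fires (PROVED) -/

/-- **Gen 11's two-long-block class law AT EVERY INSTANCE WHERE THE COVER GUARD FIRES** (no conjecture node; only the window
hypotheses of zone C are used — the guard itself carries the class-structure information). -/
theorem twoLongClassLaw_of_coverGuard (b : ℕ → ℤ) {j p i₁ i₂ : ℕ} (hb : InPolytope b) (hj1 : 1 ≤ j) (hj7 : j ≤ 7)
    (hb' : InPolytope (shift b j)) (hp : p.Prime) (hp5 : 5 ≤ p) (hb3 : b 0 < 3 * (p : ℤ))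
    (hg : coverGuard b j p (zcBonus b p i₁ i₂) = true) (hcas : casoratian b j ≠ 0) :
    refund b p - pairFloors b p + zcBonus b p i₁ i₂ ≤ padicValRat p (casoratian b j) :=
  classLaw_of_coverGuard b hb hj1 hj7 hb' hp hp5 (win_of_lt_three_p hp5 hb3) hg hcas

/-! ### The residual node and the reduction -/

/-- **THE RESIDUAL OF THE TWO-LONG-BLOCK CLASS LAW, OBSERVED** (minted by this cell; NOT a published result): gen 11's node
`TwoLongClassLaw` on the zone-C instances at which the cover guard of `RVClassLawCover` does NOT fire at level `zcBonus`.  Exact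
census (module docstring): 848 instances in 25 configuration types at `p = 5` and 6,342 in 51 types at `p = 7` (complete), every
one with `Γ ≥ 1`, the node attained with equality in 803 resp. 6,070 of them and exceeded by at most `3` in the others. -/
@[conjecture] def TwoLongResidual : Prop :=
  ∀ (b : ℕ → ℤ) (j p i₁ i₂ : ℕ), InPolytope b → 1 ≤ j → j ≤ 7 → InPolytope (shift b j) → p.Prime → 5 ≤ p →
    b 0 < 3 * (p : ℤ) → i₁ < 7 → i₂ < 7 → i₁ ≠ i₂ →
    (p : ℤ) ≤ b 0 - 2 * b (i₁ + 1) → (p : ℤ) ≤ b 0 - 2 * b (i₂ + 1) → b (i₁ + 1) ≤ b (i₂ + 1) →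
    (∀ k ∈ ((range 7).erase i₁).erase i₂, b 0 - 2 * b (k + 1) < p) →
    coverGuard b j p (zcBonus b p i₁ i₂) = false → casoratian b j ≠ 0 →
    refund b p - pairFloors b p + zcBonus b p i₁ i₂ ≤ padicValRat p (casoratian b j)

/-- **residual ⇒ node**: gen 11's `TwoLongClassLaw` follows from its residual (the covered instances are theorems). -/
theorem twoLongClassLaw_of_residual (h : TwoLongResidual) : TwoLongClassLaw := by
  intro b j p i₁ i₂ hb hj1 hj7 hb' hp hp5 hb3 hi₁ hi₂ hne hL₁ hL₂ hle hshort hcas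
  by_cases hg : coverGuard b j p (zcBonus b p i₁ i₂) = true
  · exact twoLongClassLaw_of_coverGuard b hb hj1 hj7 hb' hp hp5 hb3 hg hcas
  · exact h b j p i₁ i₂ hb hj1 hj7 hb' hp hp5 hb3 hi₁ hi₂ hne hL₁ hL₂ hle hshort (by simpa using hg) hcas

/-- **residual ⇒ the flat `S₇`-gauge law on zone C** (through gen 11's `flatGaugeLawZoneC_of_twoLongClassLaw`). -/
theorem flatGaugeLawZoneC_of_residual (h : TwoLongResidual) : FlatGaugeLawZoneC :=
  flatGaugeLawZoneC_of_twoLongClassLaw (twoLongClassLaw_of_residual h)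

/-- Conversely the node contains its residual (consistency). -/
theorem residual_of_twoLongClassLaw (h : TwoLongClassLaw) : TwoLongResidual :=
  fun b j p i₁ i₂ hb hj1 hj7 hb' hp hp5 hb3 hi₁ hi₂ hne hL₁ hL₂ hle hshort _ hcas =>
    h b j p i₁ i₂ hb hj1 hj7 hb' hp hp5 hb3 hi₁ hi₂ hne hL₁ hL₂ hle hshort hcas

/-! ### Kernel instances (the bonus and the guard are computable) -/

/-- `b = (11; 5,5,5,5,4,3,0)` at `p = 5`, long slots `i₁ = 6`, `i₂ = 5` (`b₇ = 0 ≤ b₆ = 3`): zone C with `Γ = 1`, and the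
guard fires at `δ = zcBonus = 1` (disjunct (Z): `H(3)` and both constant terms of `b`, `b + e_5` pass a (V⁺) test at `−N_5 + 1 = −5`)
— the node `v_5 Cas_5(b) ≥ −4` is a theorem here (exact value `−4`). -/
def bR1 : ℕ → ℤ := fun i => (([11, 5, 5, 5, 5, 4, 3, 0] : List ℤ).getD i 0)

/-- `b = (10; 5,3,3,3,3,1,1)` at `p = 5`, long slots `5, 6`: the smallest RESIDUAL instance (`j = 2`) — `Γ = 1`, node value
`refund − N_5 + 1 = −7`; at `δ = 0` the guard fires ((J): (CV) `v ≥ −8` is a theorem), at `δ = 1` it does not (exact value `−7`). -/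
def bR2 : ℕ → ℤ := fun i => (([10, 5, 3, 3, 3, 3, 1, 1] : List ℤ).getD i 0)

set_option maxRecDepth 200000 in
set_option maxHeartbeats 1000000 in
/-- The bonus of the first example (kernel; the path maximum runs over the `7!` relabellings): `zcBonus(bR1) = Γ = 1`. -/
theorem zcBonus_bR1 : zcBonus bR1 5 6 5 = 1 := by
  decide +kernel

set_option maxRecDepth 200000 in
set_option maxHeartbeats 1000000 in
/-- The bonus of the second example (kernel): `zcBonus(bR2) = Γ = 1`. -/
theorem zcBonus_bR2 : zcBonus bR2 5 5 6 = 1 := by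
  decide +kernel

/-- The guards of the two examples (kernel): covered at its bonus level / covered only without the bonus. -/
theorem coverGuard_examples : coverGuard bR1 5 5 1 = true ∧ coverGuard bR2 2 5 0 = true ∧ coverGuard bR2 2 5 1 = false := by
  refine ⟨?_, ?_, ?_⟩ <;> decide

/-- Hence the node at the instance `(bR1, j = 5, p = 5, i₁ = 6, i₂ = 5)` is a THEOREM (whatever the value of the Casoratian). -/
example (hb : InPolytope bR1) (hb' : InPolytope (shift bR1 5)) (hcas : casoratian bR1 5 ≠ 0) :
    refund bR1 5 - pairFloors bR1 5 + zcBonus bR1 5 6 5 ≤ padicValRat 5 (casoratian bR1 5) :=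
  twoLongClassLaw_of_coverGuard bR1 hb (by norm_num) (by norm_num) hb' (by norm_num) le_rfl (by decide)
    (by rw [zcBonus_bR1]; exact coverGuard_examples.1) hcas

end Summit.KontsevichZagierPeriods.Zeta5Search.RVFlatGauge

end
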